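import Mathlib
import Summits.PneNP.PneNP.Theorems.ClusUniversalCertificateCoordBox
import Summits.PneNP.PneNP.Theorems.ClusUniversalCertificateCoordSaturation

/-!
# Route ClusUniversalCertificate, crux `UniversalCertAll` (stmt-PneNP-19683) — Hall level one of the positive-part certificate

Support file (`--supports stmt-PneNP-19683`); objects of record `…Theorems.ClusCoord` (`bsize`, `zcount`); uses the box lemma
(`ClusCoordBox.sat_of_tight`) and the saturation bound (`ClusCoordSaturation.card_sat_le_zcount`).

**Theorem (`card_boxPoints_le`).**  Fix a block `j`.  The points `y ∈ Y ⊆ 𝔽₂^M` carrying a flat `A ∋ y` inside `Y` that avoids the zero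
pattern of every block `k ≠ j` and has `dim A + (n − 1) ≥ M` (certificate codimension `≤ n − 1` achieved by a flat onto no block other than `j`,
zero-normalised) number at most `2^{b_j} · Z_j(Y)`.

This is the level `|J| = 1` of the Hall family `HF(J) : Σ_{y : onto-blocks(A_y) ⊆ J} (n − acodim y)⁺ ≤ Σ_{j∈J} 2^{b_j} μ_j` into which the
positive-part certificate `UC⁺` (⇒ `UCMix`) splits; levels `J ≠ univ` follow from `UC⁺` in smaller total dimension by sectioning along a block
outside `J`, so the open content of `stub_core` (line `slicing`) is the top level — FULL points, whose optimal flats are onto every block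
(folder census of prover leafhand-pnenp-clusuniversalcerti-2, 2026-08-31).  HONEST FRAMING: a support lemma; the crux is OPEN; FRONTIER rung F-N1 —
nothing here bears on P vs NP.
-/

set_option linter.dupNamespace false -- `Summit.PneNP.PneNP.…`: summit = sub-problem name (D-0017 single-conjunct layout)

namespace Summit.PneNP.PneNP.Theorems.ClusCoordHallOne

open Finset
open Summit.PneNP.PneNP.Theorems.ClusCoord (bsize zcount)
open Summit.PneNP.PneNP.Theorems.ClusCoordBox (sat_of_tight)
open Summit.PneNP.PneNP.Theorems.ClusCoordSaturation (card_sat_le_zcount)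

variable {M n : ℕ}

open Classical in
/-- **Hall level one.**  Points with a codimension-`(n−1)` flat inside `Y` that is zero-avoiding on every block other than `j` are
`j`-saturated, hence number at most `2^{b_j} Z_j(Y)`. -/
theorem card_boxPoints_le (blk : Fin M → Fin n) (j : Fin n) (Y : Finset (Fin M → ZMod 2)) :
    (Y.filter fun y => ∃ A : AffineSubspace (ZMod 2) (Fin M → ZMod 2), y ∈ A ∧ (∀ z ∈ A, z ∈ Y) ∧
        M ≤ Module.finrank (ZMod 2) A.direction + (n - 1) ∧
        ∀ k : Fin n, k ≠ j → ∀ z ∈ A, ¬ (∀ i, blk i = k → z i = 0)).card ≤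
      2 ^ bsize blk j * zcount blk j Y := by
  refine le_trans (Finset.card_le_card ?_) (card_sat_le_zcount blk j Y)
  intro y hy
  rw [Finset.mem_filter] at hy ⊢
  obtain ⟨hyY, A, hyA, hAY, hdim, havoid⟩ := hy
  refine ⟨hyY, fun w hw => ?_⟩
  have hcard : (Finset.univ.erase j).card = n - 1 := by
    rw [Finset.card_erase_of_mem (Finset.mem_univ j), Finset.card_univ, Fintype.card_fin]
  refine sat_of_tight blk Y A hAY y hyA (Finset.univ.erase j) ?_ ?_ y hyA j (Finset.notMem_erase j _) w hw
  · intro k hk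
    exact havoid k (Finset.ne_of_mem_erase hk)
  · rw [hcard]; exact hdim

/-! ## Appendix (same session): the general tight level and a precision note

PRECISION on the module docstring above: the Hall levels `HF(J)`, `J ≠ univ`, follow from `UC⁺` in smaller total dimension (section along
the blocks outside `J`), but the top level `J = univ` is the TOTAL inequality over all points and is NOT implied by the lower levels (Hall
conditions do not sum).  What sectioning along one block `l` proves from the induction hypothesis is
`Σ_y (n − acodim y) ≤ Σ_{j ≠ l} 2^{b_j} μ_j + #{y : optimal flat onto block l}` (the section rule OBL-∃, refuted on W130 where every optimal flat is
onto every block); averaging over `l` credits a point `ns(y)·d + (n − ns(y))(d − 1)⁺ ≥ (n−1)·d` exactly when `ns(y) ≥ acodim(y)`, i.e. for points whose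
optimal flat is a BOX (flat lemma tight, "skew" `acodim − ns = 0`); the uncredited quantity is the skew of onto flats.  Equivalently, with
`excess_j := #{y : optimal flat onto j} − 2^{b_j} μ_j`, the certificate reads `Σ_j excess_j ≤ Σ_y skew(y)`, and its single-block level
`excess_j ≤ Σ_{y onto j} skew(y)` HOLDS because skew-0 points onto `j` are `j`-saturated — the content of `card_tightPoints_le` below
(any set `J ∌ j` of zero-avoided blocks with the flat lemma tight); the multi-block levels `Σ_{j∈J} excess_j ≤ Σ_{y : onto(y) ∩ J ≠ ∅} skew(y)` have no
known counterexample (folder census 2026-08-31: ≈ 27 000 random sets, flat unions and hill-climbs at (2,1,1,1), (2,2,1), (2,2,2), (3,1,1), (2,2,1,1); minimum margin 0).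
-/

open Classical in
/-- **Tight level, general `J`.**  Points of `Y` carrying a flat inside `Y` that avoids the zero pattern of every block of a set `J ∌ j` with the
flat lemma tight (`dim A + |J| ≥ M`, i.e. skew `0` after zero-normalisation) are `j`-saturated, hence number at most `2^{b_j} Z_j(Y)`. -/
theorem card_tightPoints_le (blk : Fin M → Fin n) (j : Fin n) (J : Finset (Fin n)) (hj : j ∉ J)
    (Y : Finset (Fin M → ZMod 2)) :
    (Y.filter fun y => ∃ A : AffineSubspace (ZMod 2) (Fin M → ZMod 2), y ∈ A ∧ (∀ z ∈ A, z ∈ Y) ∧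
        M ≤ Module.finrank (ZMod 2) A.direction + J.card ∧
        ∀ k ∈ J, ∀ z ∈ A, ¬ (∀ i, blk i = k → z i = 0)).card ≤
      2 ^ bsize blk j * zcount blk j Y := by
  refine le_trans (Finset.card_le_card ?_) (card_sat_le_zcount blk j Y)
  intro y hy
  rw [Finset.mem_filter] at hy ⊢
  obtain ⟨hyY, A, hyA, hAY, hdim, havoid⟩ := hy
  exact ⟨hyY, fun w hw => sat_of_tight blk Y A hAY y hyA J havoid hdim y hyA j hj w hw⟩

end Summit.PneNP.PneNP.Theorems.ClusCoordHallOne
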